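import Literature.NumberTheory.Weil1964.AdelicMetaplecticTensorStripping
import Literature.NumberTheory.Automorphic.AdelicTensorStrippingLF
import HarnessLib

-- buildfix G11b-3 recipe (LEDGER B13-1/B13-3): elaborate sequentially so the trailing `attribute [implicit_reducible]`
-- block (reducibilityCoreExt is keyed to the async environment branch) is in force at `.olean` export.
set_option Elab.async false

/-!
# The archimedean read-off `ω_∞(g) := archPart ω(g)` of an archimedean representation on `𝒮(𝔸_K^ι)`

Topic `NumberTheory/Weil1964`; namespace `Literature.NumberTheory.Weil1964`. Origin: `pub-hodgecm`
MODEL-CONSTRUCTION sub-cell, theta-2 lineage gen 5 (node W6a; E-binder `C : ArchKTypeData`, fields (W-ω) `ωinf`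
and (W-⊗′) `prodN`). KERNEL MATHEMATICS ONLY: no `def … : Prop` record, no `axiom`, no proof hole; imports =
Mathlib + tree.

THE CONSTRUCTION. Let `ρ : G →* End 𝒮(𝔸_K^ι)` be a representation on the adelic Schwartz–Bruhat space
`piSchwartzBruhat K ι = 𝓢((K ⊗ ℝ)^ι) ⊗ 𝒮((𝔸_K^∞)^ι)` every operator of which is ARCHIMEDEAN, i.e. of the form
`A ⊗ 1` — equivalently (`comm_finite_heisenberg_iff` of `AdelicTensorStripping`) commutes with all finite
Heisenberg translations and modulations. Then `g ↦ archPart (ρ g)` (the archimedean part of (S-∞),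
`AdelicTensorStripping.archPart`) IS A REPRESENTATION **`archRep ρ`** of `G` on `𝓢((K ⊗ ℝ)^ι)` (§1–§2:
`archPart (A ⊗ 1) = A`, so `archPart` is multiplicative on archimedean operators), with
`ρ g = archRep ρ g ⊗ 1` and, on the thin-coset test functions `Φ_∞ ⊗ 𝟙_{x₀ + (𝔫𝒪̂)^ι}` of
`SchwartzBruhatCosetIndicator` (`thinCosetTestFunₗ x₀ 𝔫`),

  **`ρ g (Φ_∞ ⊗ 𝟙_{x₀ + 𝔫𝒪̂^ι}) = (archRep ρ g Φ_∞) ⊗ 𝟙_{x₀ + 𝔫𝒪̂^ι}`**   (`archRep_thinCosetTestFunₗ`),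

and conversely ANY operator `A` with this identity at ONE pair `(x₀, 𝔫)` is `archRep ρ g` (`archRep_unique`;
the family `Φ_∞ ↦ Φ_∞ ⊗ 𝟙_{x₀ + 𝔫𝒪̂^ι}` is injective, `thinCosetTestFunₗ_injective`, by the archimedean slice
at `x₀`). Intertwining relations `ρ g ∘ (U ⊗ 1) = (U' ⊗ 1) ∘ ρ g` descend to `archRep ρ g ∘ U = U' ∘ archRep ρ g`
(`archRep_comp_eq_of_comp_eq`). §3 instantiates this at the adelic metaplectic group of record: for a
homomorphism `s : H →* Mp_ψ(W_𝔸)ᶜᵒⁿᵗ` (`adelicMpCont`) whose symplectic projections FIX the finite Heisenberg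
elements (`finHeisenberg`; "`s(h)` has trivial finite component") the Weil operators `ω(s h)` commute with the
finite Heisenberg operators (condition (A) and the dictionary of `AdelicMetaplecticTensorStripping` §2), so
**`archRepMp s : H →* End 𝓢((F ⊗ ℝ)^ι)`** is defined, `ω(s h) = archRepMp s h ⊗ 1`, the test-function identity
holds, and every `archRepMp s h` is a TOPOLOGICAL AUTOMORPHISM of `𝓢((F ⊗ ℝ)^ι)` (LF-continuity of
`Mp_ψ(W_𝔸)ᶜᵒⁿᵗ`, `IsLFContinuous.continuous_archPart`): `archRepMpCLM s : H →* (𝓢 →L[ℂ] 𝓢)`, `archRepMpCLE s h`.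
This is the operator- and group-level form of Weil's factorisation `𝐫_𝐀(s) = ⊗_v 𝐫_v(s_v)` on the archimedean
factor `s = (s_∞, 1)` [Weil1964, Chap. III n° 37–38 p. 188–190]: the archimedean Weil representation is READ OFF
the adelic one.

USE (`pub-hodgecm`, RUN 34, recorded for the carvers; nothing here depends on it): with `ρ := ω_S ∘ (ι_∞(·), 1)`
the archimedean-factor restriction of the model's adelic Weil representation, `archRep ρ` is a TERM for the field
`ArchKTypeData.ωinf` and `archRep_thinCosetTestFunₗ` is the field `prodN` (PKG
`testFun K J Φ x₀ N = thinCosetTestFunₗ (finEmb K J x₀) (span {N}) Φ`), modulo the one explicit hypothesis that the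
symplectic projections of `ι_∞(g)` fix the finite Heisenberg elements; `archRep_unique` says `prodN` determines
`ωinf`.

## References

* [Weil1964] A. Weil, *Sur certains groupes d'opérateurs unitaires*, Acta Math. 111 (1964) 143–211, Chap. I
  n° 4 p. 149 (`U(w)`), Chap. III n° 37–38 p. 188–190 (`Mp_𝐀`, `𝐫_𝐀 = ⊗_v 𝐫_v`, standard functions).
* [GelbartRogawski1991] S. Gelbart, J. Rogawski, *L-functions and Fourier–Jacobi coefficients for the unitary
  group U(3)*, Invent. math. 105 (1991) 445–472, §3.1 p. 454 (the pairs `(g, M_g)`).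
* [MoeglinVignerasWaldspurger1987] C. Mœglin, M.-F. Vignéras, J.-L. Waldspurger, *Correspondances de Howe sur
  un corps p-adique*, LNM 1291 (1987), Chap. 2 II.1 (A).

## Provenance

LEAN-IN-TREE rule (2026-08-18), pub-hodgecm model-construction sub-cell, seat mc-theta-2 gen 5 (successor of
the (S-∞)/(⊗S)-𝔸 files of gens 2–3: `AdelicTensorStripping{,LF,Covariant}`, `AdelicMetaplecticTensorStripping`,
`AdelicMetaplecticFiniteImplementer`).
-/

set_option autoImplicit false

noncomputable section

open scoped Matrix SchwartzMap TensorProduct Classical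

open NumberField NumberField.mixedEmbedding IsDedekindDomain

namespace Literature.NumberTheory.Weil1964

open Literature.NumberTheory.Automorphic Literature.RepresentationTheory.HeisenbergGroup

/-! ### §1 `archPart (A ⊗ 1) = A`; the slice recovers `Φ_∞` from `Φ_∞ ⊗ 𝟙_{x₀ + 𝔫𝒪̂^ι}` -/

section ArchPart

variable {K : Type} [Field K] [NumberField K] {ι : Type} [Fintype ι]

/-- **`archPart (A ⊗ 1) = A`**: the archimedean part of a pure archimedean operator is its archimedean factor
(`𝟙_{𝒪̂^ι}(0) = 1`). [folklore] -/
theorem archPart_adelicTensorEnd_id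
    (A : 𝓢((ι → mixedSpace K), ℂ) →ₗ[ℂ] 𝓢((ι → mixedSpace K), ℂ)) :
    archPart (adelicTensorEnd A LinearMap.id) = A := by
  apply LinearMap.ext
  intro Φ
  have h0 : (0 : ι → FiniteAdeleRing (𝓞 K) K) ∈ (piLevelIdeal K ι ⊤ : Set (ι → FiniteAdeleRing (𝓞 K) K)) :=
    (piLevelIdeal K ι ⊤).zero_mem
  rw [archPart, archFactor_apply, adelicTensorEnd_apply_tmul, LinearMap.id_apply, archSliceLM_tmul,
    coe_indicatorSB]
  simp only [Set.indicator_of_mem h0, one_smul]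

/-- `archPart 1 = 1`. [folklore] -/
theorem archPart_one : archPart (1 : Module.End ℂ ↥(piSchwartzBruhat K ι)) = 1 := by
  rw [← adelicTensorEnd_one]
  exact archPart_adelicTensorEnd_id 1

/-- Existence form of (S-∞): an operator commuting with the finite Heisenberg translations and modulations is
`A ⊗ 1` for some `A` (namely `archPart`). [folklore] -/
theorem exists_eq_adelicTensorEnd_id_of_comm (M : ↥(piSchwartzBruhat K ι) →ₗ[ℂ] ↥(piSchwartzBruhat K ι))
    (hT : ∀ k, M ∘ₗ translateLM K ι (piAdeleSplit K ι (0, k)) =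
      translateLM K ι (piAdeleSplit K ι (0, k)) ∘ₗ M)
    (hM : ∀ y, M ∘ₗ modulateLM K ι (piAdeleSplit K ι (0, y)) =
      modulateLM K ι (piAdeleSplit K ι (0, y)) ∘ₗ M) :
    ∃ A : 𝓢((ι → mixedSpace K), ℂ) →ₗ[ℂ] 𝓢((ι → mixedSpace K), ℂ), M = adelicTensorEnd A LinearMap.id :=
  ⟨archPart M, eq_adelicTensorEnd_archPart_id M hT hM⟩

/-- **The archimedean slice at `x₀` recovers `Φ_∞` from the thin-coset test function `Φ_∞ ⊗ 𝟙_{x₀ + 𝔫𝒪̂^ι}`**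
(`𝟙_{x₀ + 𝔫𝒪̂^ι}(x₀) = 1`). [folklore] -/
theorem archSliceLM_thinCosetTestFunₗ (x₀ : ι → FiniteAdeleRing (𝓞 K) K) (𝔫 : Ideal (𝓞 K))
    (Φ : 𝓢((ι → mixedSpace K), ℂ)) :
    archSliceLM K ι x₀ (thinCosetTestFunₗ (K := K) (ι := ι) x₀ 𝔫 Φ) = Φ := by
  have h0 : (0 : ι → FiniteAdeleRing (𝓞 K) K) ∈ (piLevelIdeal K ι 𝔫 : Set (ι → FiniteAdeleRing (𝓞 K) K)) :=
    (piLevelIdeal K ι 𝔫).zero_mem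
  rw [thinCosetTestFunₗ_eq_tmul, archSliceLM_tmul]
  simp only [coe_finTranslateSB_apply, coe_indicatorSB, neg_add_cancel, Set.indicator_of_mem h0, one_smul]

/-- **The thin-coset family `Φ_∞ ↦ Φ_∞ ⊗ 𝟙_{x₀ + 𝔫𝒪̂^ι}` is injective.** [folklore] -/
theorem thinCosetTestFunₗ_injective (x₀ : ι → FiniteAdeleRing (𝓞 K) K) (𝔫 : Ideal (𝓞 K)) :
    Function.Injective (thinCosetTestFunₗ (K := K) (ι := ι) x₀ 𝔫) := fun Φ Ψ h => by
  rw [← archSliceLM_thinCosetTestFunₗ x₀ 𝔫 Φ, h, archSliceLM_thinCosetTestFunₗ]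

end ArchPart

/-! ### §2 The archimedean read-off representation `archRep ρ` -/

section ArchRep

variable {K : Type} [Field K] [NumberField K] {ι : Type} [Fintype ι] {G : Type*} [Monoid G]

/-- **The archimedean read-off `archRep ρ : G →* End 𝓢((K ⊗ ℝ)^ι)`, `g ↦ archPart (ρ g)`**, of a representation
`ρ` on `𝒮(𝔸_K^ι)` all of whose operators are archimedean (`ρ g = A_g ⊗ 1`). Multiplicativity: `archPart` is the
inverse of the injective monoid map `A ↦ A ⊗ 1` on its image. [cite: Weil1964, Chap. III n° 37–38 p. 188–190] -/
def archRep (ρ : Representation ℂ G ↥(piSchwartzBruhat K ι))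
    (hρ : ∀ g, ∃ A : 𝓢((ι → mixedSpace K), ℂ) →ₗ[ℂ] 𝓢((ι → mixedSpace K), ℂ),
      ρ g = adelicTensorEnd A LinearMap.id) :
    Representation ℂ G 𝓢((ι → mixedSpace K), ℂ) where
  toFun g := archPart (ρ g)
  map_one' := by
    show archPart (ρ 1) = 1
    rw [map_one]
    exact archPart_one
  map_mul' g g' := by
    show archPart (ρ (g * g')) = archPart (ρ g) * archPart (ρ g')
    obtain ⟨A, hA⟩ := hρ g
    obtain ⟨A', hA'⟩ := hρ g'
    have hid : (LinearMap.id : FinSB K ι →ₗ[ℂ] FinSB K ι) * LinearMap.id = LinearMap.id :=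
      LinearMap.ext fun _ => rfl
    rw [map_mul, hA, hA', ← adelicTensorEnd_mul, hid]
    simp only [archPart_adelicTensorEnd_id]

variable (ρ : Representation ℂ G ↥(piSchwartzBruhat K ι))
  (hρ : ∀ g, ∃ A : 𝓢((ι → mixedSpace K), ℂ) →ₗ[ℂ] 𝓢((ι → mixedSpace K), ℂ),
    ρ g = adelicTensorEnd A LinearMap.id)

/-- Unfolding: `archRep ρ g = archPart (ρ g)`. [folklore] -/
@[simp] theorem archRep_apply (g : G) : archRep ρ hρ g = archPart (ρ g) := rfl

/-- **`ρ g = archRep ρ g ⊗ 1`.** [cite: Weil1964, Chap. III n° 37–38 p. 188–190] -/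
theorem eq_adelicTensorEnd_archRep (g : G) : ρ g = adelicTensorEnd (archRep ρ hρ g) LinearMap.id := by
  obtain ⟨A, hA⟩ := hρ g
  rw [archRep_apply, hA, archPart_adelicTensorEnd_id]

/-- On pure tensors: `ρ g (Φ_∞ ⊗ f) = (archRep ρ g Φ_∞) ⊗ f`. [cite: Weil1964, Chap. III n° 37–38 p. 188–190] -/
theorem archRep_map_tmul (g : G) (Φinf : 𝓢((ι → mixedSpace K), ℂ)) (f : FinSB K ι) :
    ρ g (piSchwartzBruhatEquiv K ι (Φinf ⊗ₜ f)) = piSchwartzBruhatEquiv K ι (archRep ρ hρ g Φinf ⊗ₜ f) := by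
  rw [eq_adelicTensorEnd_archRep ρ hρ g, adelicTensorEnd_apply_tmul, LinearMap.id_apply]

/-- **The test-function identity** (shape of `pub-hodgecm`'s `ArchKTypeData.prodN`): on the thin-coset test
functions of any level and base point, `ρ g (Φ_∞ ⊗ 𝟙_{x₀ + 𝔫𝒪̂^ι}) = (archRep ρ g Φ_∞) ⊗ 𝟙_{x₀ + 𝔫𝒪̂^ι}`.
[cite: Weil1964, Chap. III n° 37–38 p. 188–190] -/
theorem archRep_thinCosetTestFunₗ (g : G) (x₀ : ι → FiniteAdeleRing (𝓞 K) K) (𝔫 : Ideal (𝓞 K))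
    (Φ : 𝓢((ι → mixedSpace K), ℂ)) :
    ρ g (thinCosetTestFunₗ (K := K) (ι := ι) x₀ 𝔫 Φ) =
      thinCosetTestFunₗ (K := K) (ι := ι) x₀ 𝔫 (archRep ρ hρ g Φ) := by
  rw [thinCosetTestFunₗ_eq_tmul, thinCosetTestFunₗ_eq_tmul, archRep_map_tmul]

/-- **Uniqueness: the test-function identity at ONE `(x₀, 𝔫)` determines the archimedean operator.** If a linear
`A` satisfies `ρ g (Φ_∞ ⊗ 𝟙_{x₀ + 𝔫𝒪̂^ι}) = (A Φ_∞) ⊗ 𝟙_{x₀ + 𝔫𝒪̂^ι}` for all `Φ_∞`, then `A = archRep ρ g`.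
[folklore] -/
theorem archRep_unique (g : G) (x₀ : ι → FiniteAdeleRing (𝓞 K) K) (𝔫 : Ideal (𝓞 K))
    {A : 𝓢((ι → mixedSpace K), ℂ) →ₗ[ℂ] 𝓢((ι → mixedSpace K), ℂ)}
    (hA : ∀ Φ, ρ g (thinCosetTestFunₗ (K := K) (ι := ι) x₀ 𝔫 Φ) =
      thinCosetTestFunₗ (K := K) (ι := ι) x₀ 𝔫 (A Φ)) :
    A = archRep ρ hρ g :=
  LinearMap.ext fun Φ =>
    thinCosetTestFunₗ_injective x₀ 𝔫 ((hA Φ).symm.trans (archRep_thinCosetTestFunₗ ρ hρ g x₀ 𝔫 Φ))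

/-- Uniqueness, function form: any map `A` (not assumed linear) with the test-function identity at one `(x₀, 𝔫)`
agrees with `archRep ρ g` pointwise. [folklore] -/
theorem eq_archRep_apply_of_thinCosetTestFunₗ (g : G) (x₀ : ι → FiniteAdeleRing (𝓞 K) K) (𝔫 : Ideal (𝓞 K))
    {A : 𝓢((ι → mixedSpace K), ℂ) → 𝓢((ι → mixedSpace K), ℂ)}
    (hA : ∀ Φ, ρ g (thinCosetTestFunₗ (K := K) (ι := ι) x₀ 𝔫 Φ) =
      thinCosetTestFunₗ (K := K) (ι := ι) x₀ 𝔫 (A Φ)) (Φ : 𝓢((ι → mixedSpace K), ℂ)) :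
    A Φ = archRep ρ hρ g Φ :=
  thinCosetTestFunₗ_injective x₀ 𝔫 ((hA Φ).symm.trans (archRep_thinCosetTestFunₗ ρ hρ g x₀ 𝔫 Φ))

/-- **Intertwiners descend**: a relation `ρ g ∘ (U ⊗ 1) = (U' ⊗ 1) ∘ ρ g` on `𝒮(𝔸_K^ι)` gives
`archRep ρ g ∘ U = U' ∘ archRep ρ g` on `𝓢((K ⊗ ℝ)^ι)` (injectivity of `A ↦ A ⊗ 1`). This is how Heisenberg
covariance over the archimedean places and `K_∞`-equivariance pass to the read-off. [folklore] -/
theorem archRep_comp_eq_of_comp_eq (g : G) {U U' : 𝓢((ι → mixedSpace K), ℂ) →ₗ[ℂ] 𝓢((ι → mixedSpace K), ℂ)}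
    (h : ρ g ∘ₗ adelicTensorEnd U LinearMap.id = adelicTensorEnd U' LinearMap.id ∘ₗ ρ g) :
    archRep ρ hρ g ∘ₗ U = U' ∘ₗ archRep ρ hρ g := by
  have hid : (LinearMap.id : FinSB K ι →ₗ[ℂ] FinSB K ι) ∘ₗ LinearMap.id = LinearMap.id := rfl
  rw [eq_adelicTensorEnd_archRep ρ hρ g, ← adelicTensorEnd_comp, ← adelicTensorEnd_comp, hid] at h
  exact adelicTensorEnd_id_injective h

/-- Fixed vectors descend: `ρ g (Φ_∞ ⊗ f) = Φ_∞ ⊗ f` with `f ≠ 0` forces `archRep ρ g Φ_∞ = Φ_∞`; stated on a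
thin-coset test function. [folklore] -/
theorem archRep_apply_eq_self_of_thinCosetTestFunₗ (g : G) (x₀ : ι → FiniteAdeleRing (𝓞 K) K) (𝔫 : Ideal (𝓞 K))
    {Φ : 𝓢((ι → mixedSpace K), ℂ)}
    (h : ρ g (thinCosetTestFunₗ (K := K) (ι := ι) x₀ 𝔫 Φ) = thinCosetTestFunₗ (K := K) (ι := ι) x₀ 𝔫 Φ) :
    archRep ρ hρ g Φ = Φ :=
  thinCosetTestFunₗ_injective x₀ 𝔫 ((archRep_thinCosetTestFunₗ ρ hρ g x₀ 𝔫 Φ).symm.trans h)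

end ArchRep

/-! ### §3 The instance at `Mp_ψ(W_𝔸)ᶜᵒⁿᵗ`: `ω(s h) = archRepMp s h ⊗ 1` for finite-trivial `s` -/

section Mp

variable {F : Type} [Field F] [NumberField F] {ι : Type} [Fintype ι] [DecidableEq ι]
  {T : Matrix ι ι (AdeleRing (𝓞 F) F)}

/-- **Condition (A) + finite triviality ⇒ commutation with the finite translations**, pointwise: if the
symplectic projection of `p ∈ Mp_ψ(W_𝔸)ᶜᵒⁿᵗ` fixes every finite Heisenberg element, `ω(p)` commutes with all
`T_(0,k)`. [cite: MoeglinVignerasWaldspurger1987, Chap. 2 II.1 (A); Weil1964, Chap. I n° 4 p. 149] -/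
theorem omega_translateLM_apply_of_act_finHeisenberg (p : adelicMpCont F ι T)
    (hfin : ∀ w ∈ finHeisenberg T,
      (ofSymplectic (polar (adelicForm F ι T)) (adelicMpCont.proj F ι T p)).act w = w)
    (k : ι → FiniteAdeleRing (𝓞 F) F) (Φ : piSchwartzBruhat F ι) :
    adelicMpCont.omega F ι T p (translateLM F ι (piAdeleSplit F ι (0, k)) Φ) =
      translateLM F ι (piAdeleSplit F ι (0, k)) (adelicMpCont.omega F ι T p Φ) := by
  have hex := exists_mem_finHeisenberg_eq_translateLM (T := T) k
  rcases hex with ⟨w, hw, hρw⟩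
  have hImp := (mem_MpPsi _ _).1 (p : adelicMp F ι T).2 w Φ
  have hw' := hfin w hw
  rw [adelicMpCont.proj_apply, MpPsi.proj_apply] at hw'
  rw [hw', hρw] at hImp
  show ((p : adelicMp F ι T) : symplecticGroup (polar (adelicForm F ι T)) ×
        (piSchwartzBruhat F ι ≃ₗ[ℂ] piSchwartzBruhat F ι)).2 (translateLM F ι (piAdeleSplit F ι (0, k)) Φ) =
      translateLM F ι (piAdeleSplit F ι (0, k))
        (((p : adelicMp F ι T) : symplecticGroup (polar (adelicForm F ι T)) ×
          (piSchwartzBruhat F ι ≃ₗ[ℂ] piSchwartzBruhat F ι)).2 Φ)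
  exact hImp

/-- LinearMap form of `omega_translateLM_apply_of_act_finHeisenberg`. [folklore] -/
theorem omega_comp_translateLM_of_act_finHeisenberg (p : adelicMpCont F ι T)
    (hfin : ∀ w ∈ finHeisenberg T,
      (ofSymplectic (polar (adelicForm F ι T)) (adelicMpCont.proj F ι T p)).act w = w)
    (k : ι → FiniteAdeleRing (𝓞 F) F) :
    adelicMpCont.omega F ι T p ∘ₗ translateLM F ι (piAdeleSplit F ι (0, k)) =
      translateLM F ι (piAdeleSplit F ι (0, k)) ∘ₗ adelicMpCont.omega F ι T p :=
  LinearMap.ext fun Φ => omega_translateLM_apply_of_act_finHeisenberg p hfin k Φ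

/-- **Condition (A) + finite triviality ⇒ commutation with the finite modulations**, pointwise (for
`y ↦ T y` onto, so that every finite modulation is a Schrödinger operator of a finite element).
[cite: MoeglinVignerasWaldspurger1987, Chap. 2 II.1 (A); Weil1964, Chap. I n° 4 p. 149] -/
theorem omega_modulateLM_apply_of_act_finHeisenberg
    (hTy : Function.Surjective fun y : ι → AdeleRing (𝓞 F) F => T *ᵥ y) (p : adelicMpCont F ι T)
    (hfin : ∀ w ∈ finHeisenberg T,
      (ofSymplectic (polar (adelicForm F ι T)) (adelicMpCont.proj F ι T p)).act w = w)
    (y : ι → FiniteAdeleRing (𝓞 F) F) (Φ : piSchwartzBruhat F ι) :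
    adelicMpCont.omega F ι T p (modulateLM F ι (piAdeleSplit F ι (0, y)) Φ) =
      modulateLM F ι (piAdeleSplit F ι (0, y)) (adelicMpCont.omega F ι T p Φ) := by
  have hex := exists_mem_finHeisenberg_eq_modulateLM hTy y
  rcases hex with ⟨w, hw, hρw⟩
  have hImp := (mem_MpPsi _ _).1 (p : adelicMp F ι T).2 w Φ
  have hw' := hfin w hw
  rw [adelicMpCont.proj_apply, MpPsi.proj_apply] at hw'
  rw [hw', hρw] at hImp
  show ((p : adelicMp F ι T) : symplecticGroup (polar (adelicForm F ι T)) ×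
        (piSchwartzBruhat F ι ≃ₗ[ℂ] piSchwartzBruhat F ι)).2 (modulateLM F ι (piAdeleSplit F ι (0, y)) Φ) =
      modulateLM F ι (piAdeleSplit F ι (0, y))
        (((p : adelicMp F ι T) : symplecticGroup (polar (adelicForm F ι T)) ×
          (piSchwartzBruhat F ι ≃ₗ[ℂ] piSchwartzBruhat F ι)).2 Φ)
  exact hImp

/-- LinearMap form of `omega_modulateLM_apply_of_act_finHeisenberg`. [folklore] -/
theorem omega_comp_modulateLM_of_act_finHeisenberg
    (hTy : Function.Surjective fun y : ι → AdeleRing (𝓞 F) F => T *ᵥ y) (p : adelicMpCont F ι T)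
    (hfin : ∀ w ∈ finHeisenberg T,
      (ofSymplectic (polar (adelicForm F ι T)) (adelicMpCont.proj F ι T p)).act w = w)
    (y : ι → FiniteAdeleRing (𝓞 F) F) :
    adelicMpCont.omega F ι T p ∘ₗ modulateLM F ι (piAdeleSplit F ι (0, y)) =
      modulateLM F ι (piAdeleSplit F ι (0, y)) ∘ₗ adelicMpCont.omega F ι T p :=
  LinearMap.ext fun Φ => omega_modulateLM_apply_of_act_finHeisenberg hTy p hfin y Φ

/-- **`ω(p) = A ⊗ 1` for finite-trivial `p`.** [cite: Weil1964, Chap. III n° 37–38 p. 188–190] -/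
theorem exists_omega_eq_adelicTensorEnd_id
    (hTy : Function.Surjective fun y : ι → AdeleRing (𝓞 F) F => T *ᵥ y) (p : adelicMpCont F ι T)
    (hfin : ∀ w ∈ finHeisenberg T,
      (ofSymplectic (polar (adelicForm F ι T)) (adelicMpCont.proj F ι T p)).act w = w) :
    ∃ A : 𝓢((ι → mixedSpace F), ℂ) →ₗ[ℂ] 𝓢((ι → mixedSpace F), ℂ),
      adelicMpCont.omega F ι T p = adelicTensorEnd A LinearMap.id :=
  exists_eq_adelicTensorEnd_id_of_comm _ (omega_comp_translateLM_of_act_finHeisenberg p hfin)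
    (omega_comp_modulateLM_of_act_finHeisenberg hTy p hfin)

variable {H : Type*} [Group H]

/-- **The archimedean Weil representation read off a finite-trivial homomorphism `s : H →* Mp_ψ(W_𝔸)ᶜᵒⁿᵗ`**:
`h ↦ archPart ω(s h)`. [cite: Weil1964, Chap. III n° 37–38 p. 188–190] -/
def archRepMp (hTy : Function.Surjective fun y : ι → AdeleRing (𝓞 F) F => T *ᵥ y)
    (s : H →* adelicMpCont F ι T)
    (hfin : ∀ h, ∀ w ∈ finHeisenberg T,
      (ofSymplectic (polar (adelicForm F ι T)) (adelicMpCont.proj F ι T (s h))).act w = w) :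
    Representation ℂ H 𝓢((ι → mixedSpace F), ℂ) :=
  archRep ((adelicMpCont.omega F ι T).comp s) fun h => exists_omega_eq_adelicTensorEnd_id hTy (s h) (hfin h)

variable (hTy : Function.Surjective fun y : ι → AdeleRing (𝓞 F) F => T *ᵥ y) (s : H →* adelicMpCont F ι T)
  (hfin : ∀ h, ∀ w ∈ finHeisenberg T,
    (ofSymplectic (polar (adelicForm F ι T)) (adelicMpCont.proj F ι T (s h))).act w = w)

/-- Unfolding: `archRepMp s h = archPart ω(s h)`. [folklore] -/
@[simp] theorem archRepMp_apply (h : H) : archRepMp hTy s hfin h = archPart (adelicMpCont.omega F ι T (s h)) :=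
  rfl

/-- **`ω(s h) = archRepMp s h ⊗ 1`.** [cite: Weil1964, Chap. III n° 37–38 p. 188–190] -/
theorem omega_eq_adelicTensorEnd_archRepMp (h : H) :
    adelicMpCont.omega F ι T (s h) = adelicTensorEnd (archRepMp hTy s hfin h) LinearMap.id :=
  eq_adelicTensorEnd_archRep ((adelicMpCont.omega F ι T).comp s) _ h

/-- On pure tensors: `ω(s h) (Φ_∞ ⊗ f) = (archRepMp s h Φ_∞) ⊗ f`. [cite: Weil1964, Chap. III n° 37–38 p. 188–190] -/
theorem omega_map_tmul (h : H) (Φinf : 𝓢((ι → mixedSpace F), ℂ)) (f : FinSB F ι) :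
    adelicMpCont.omega F ι T (s h) (piSchwartzBruhatEquiv F ι (Φinf ⊗ₜ f)) =
      piSchwartzBruhatEquiv F ι (archRepMp hTy s hfin h Φinf ⊗ₜ f) :=
  archRep_map_tmul ((adelicMpCont.omega F ι T).comp s) _ h Φinf f

/-- **The test-function identity for `ω ∘ s`** (shape of `ArchKTypeData.prodN`):
`ω(s h) (Φ_∞ ⊗ 𝟙_{x₀ + 𝔫𝒪̂^ι}) = (archRepMp s h Φ_∞) ⊗ 𝟙_{x₀ + 𝔫𝒪̂^ι}`. [cite: Weil1964, Chap. III n° 37–38 p. 188–190] -/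
theorem omega_thinCosetTestFunₗ (h : H) (x₀ : ι → FiniteAdeleRing (𝓞 F) F) (𝔫 : Ideal (𝓞 F))
    (Φ : 𝓢((ι → mixedSpace F), ℂ)) :
    adelicMpCont.omega F ι T (s h) (thinCosetTestFunₗ (K := F) (ι := ι) x₀ 𝔫 Φ) =
      thinCosetTestFunₗ (K := F) (ι := ι) x₀ 𝔫 (archRepMp hTy s hfin h Φ) :=
  archRep_thinCosetTestFunₗ ((adelicMpCont.omega F ι T).comp s) _ h x₀ 𝔫 Φ

/-- **Uniqueness**: the test-function identity at one `(x₀, 𝔫)` determines `archRepMp s h`. [folklore] -/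
theorem archRepMp_unique (h : H) (x₀ : ι → FiniteAdeleRing (𝓞 F) F) (𝔫 : Ideal (𝓞 F))
    {A : 𝓢((ι → mixedSpace F), ℂ) →ₗ[ℂ] 𝓢((ι → mixedSpace F), ℂ)}
    (hA : ∀ Φ, adelicMpCont.omega F ι T (s h) (thinCosetTestFunₗ (K := F) (ι := ι) x₀ 𝔫 Φ) =
      thinCosetTestFunₗ (K := F) (ι := ι) x₀ 𝔫 (A Φ)) :
    A = archRepMp hTy s hfin h :=
  archRep_unique ((adelicMpCont.omega F ι T).comp s) _ h x₀ 𝔫 hA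

/-- **Each `archRepMp s h` is continuous on `𝓢((F ⊗ ℝ)^ι)`** (LF-continuity of `ω(s h)`).
[cite: Weil1964, Chap. I n° 11–13; Chap. III n° 39 p. 189] -/
theorem continuous_archRepMp (h : H) : Continuous (archRepMp hTy s hfin h) :=
  (adelicMpCont.isLFContinuous_omega (s h)).continuous_archPart _
    (omega_comp_translateLM_of_act_finHeisenberg (s h) (hfin h))
    (omega_comp_modulateLM_of_act_finHeisenberg hTy (s h) (hfin h))

/-- **`archRepMpCLM s : H →* (𝓢 →L[ℂ] 𝓢)`** — the read-off with values in continuous operators.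
[cite: Weil1964, Chap. III n° 37–39 p. 188–190] -/
def archRepMpCLM : H →* (𝓢((ι → mixedSpace F), ℂ) →L[ℂ] 𝓢((ι → mixedSpace F), ℂ)) where
  toFun h := { archRepMp hTy s hfin h with cont := continuous_archRepMp hTy s hfin h }
  map_one' := ContinuousLinearMap.ext fun Φ => by
    show archRepMp hTy s hfin 1 Φ = Φ
    rw [map_one]
    rfl
  map_mul' h h' := ContinuousLinearMap.ext fun Φ => by
    show archRepMp hTy s hfin (h * h') Φ = archRepMp hTy s hfin h (archRepMp hTy s hfin h' Φ)
    rw [map_mul]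
    rfl

/-- Unfolding. [folklore] -/
@[simp] theorem archRepMpCLM_apply (h : H) (Φ : 𝓢((ι → mixedSpace F), ℂ)) :
    archRepMpCLM hTy s hfin h Φ = archRepMp hTy s hfin h Φ := rfl

/-- `archRepMpCLM s h` as a linear map is `archRepMp s h`. [folklore] -/
theorem coe_archRepMpCLM (h : H) :
    (archRepMpCLM hTy s hfin h : 𝓢((ι → mixedSpace F), ℂ) →ₗ[ℂ] 𝓢((ι → mixedSpace F), ℂ)) =
      archRepMp hTy s hfin h := rfl

/-- **Each `archRepMp s h` is a topological automorphism of `𝓢((F ⊗ ℝ)^ι)`**, with inverse `archRepMp s h⁻¹`.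
[cite: Weil1964, Chap. I n° 11–13; Chap. III n° 39 p. 189] -/
def archRepMpCLE (h : H) : 𝓢((ι → mixedSpace F), ℂ) ≃L[ℂ] 𝓢((ι → mixedSpace F), ℂ) :=
  ContinuousLinearEquiv.equivOfInverse (archRepMpCLM hTy s hfin h) (archRepMpCLM hTy s hfin h⁻¹)
    (fun Φ => by
      show archRepMpCLM hTy s hfin h⁻¹ (archRepMpCLM hTy s hfin h Φ) = Φ
      rw [← mul_apply_eq_comp, ← map_mul, inv_mul_cancel, map_one,
        one_apply_eq_self])
    (fun Φ => by
      show archRepMpCLM hTy s hfin h (archRepMpCLM hTy s hfin h⁻¹ Φ) = Φ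
      rw [← mul_apply_eq_comp, ← map_mul, mul_inv_cancel, map_one,
        one_apply_eq_self])

/-- Unfolding. [folklore] -/
@[simp] theorem archRepMpCLE_apply (h : H) (Φ : 𝓢((ι → mixedSpace F), ℂ)) :
    archRepMpCLE hTy s hfin h Φ = archRepMp hTy s hfin h Φ := rfl

/-- Unfolding of the inverse. [folklore] -/
@[simp] theorem archRepMpCLE_symm_apply (h : H) (Φ : 𝓢((ι → mixedSpace F), ℂ)) :
    (archRepMpCLE hTy s hfin h).symm Φ = archRepMp hTy s hfin h⁻¹ Φ := rfl

end Mp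

/-! ### Build-lane note (ops-buildfix G11b-3 recipe, LEDGER B13-1, 2026-08-21)
`lean -o` (the hub build lane, never `lean`/the gate check) runs Lean 4.32's library-suggestion indexers
(`Lean.LibrarySuggestions.SymbolFrequency` / `SineQuaNon`, from their `exportEntriesFn`) over the statement of
every local theorem that is not a denied premise; on this family's statements (very large dependent binder
telescopes through the theta-kernel / dual-pair data) that fold runs for tens of minutes to hours and the build
lane kills the job (incident G11b-3, run/shared/lean/ops/buildfix/G11b-3-DOSSIER.md). `isDeniedPremise` skips
`[implicit_reducible]` constants before any fold, and a reducibility status on a *theorem* is inert (Meta never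
unfolds `thmInfo`; the kernel ignores the attribute), so the public theorems of this file are tagged
`[implicit_reducible]` purely to keep them out of that index. Only other effect: they are not offered by
`+suggestions` premise selectors. No statement or proof is changed; superseded if the operator lands a
deny-list form (`HarnessLib.PremiseIndex`). -/
set_option allowUnsafeReducibility true in
attribute [implicit_reducible]
  archPart_adelicTensorEnd_id archPart_one exists_eq_adelicTensorEnd_id_of_comm
  archSliceLM_thinCosetTestFunₗ thinCosetTestFunₗ_injective archRep_apply
  eq_adelicTensorEnd_archRep archRep_map_tmul archRep_thinCosetTestFunₗ archRep_unique
  eq_archRep_apply_of_thinCosetTestFunₗ archRep_comp_eq_of_comp_eq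
  archRep_apply_eq_self_of_thinCosetTestFunₗ omega_translateLM_apply_of_act_finHeisenberg
  omega_comp_translateLM_of_act_finHeisenberg omega_modulateLM_apply_of_act_finHeisenberg
  omega_comp_modulateLM_of_act_finHeisenberg exists_omega_eq_adelicTensorEnd_id archRepMp_apply
  omega_eq_adelicTensorEnd_archRepMp omega_map_tmul omega_thinCosetTestFunₗ archRepMp_unique
  continuous_archRepMp archRepMpCLM_apply coe_archRepMpCLM archRepMpCLE_apply
  archRepMpCLE_symm_apply

end Literature.NumberTheory.Weil1964

end
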